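import Summits.CriticalPhenomena.PercolationContinuityZ3.Theorems.PercNearOneGluingNoHeavyLowerTailSahiMixtureHereditary

/-!
# H-MIX ⇒ OR(∞): under the hereditary mixture conjecture every finite BOOLEAN MODEL is hereditarily Sahi-nonnegative at every order

Support file of the one-cut programme (crux `NoHeavyLowerTail`, stmt-CriticalPhenomena-4575; cell `prim-masterthm`, seat P3, gen 6;
`run/shared/lean/prim/prim-masterthm/prim-masterthm-p3/HIERARCHY.md` §11 (OR(∞)), §12(k), §13).  Vocabulary: `…SahiMixtureLaw` (`coinWeight`, `orCoin`),
`…SahiMixtureHereditary` (`HereditaryAllOrders`, `@[conjecture] HereditaryMixturePositivity`, `hereditaryAllOrders_orCoin_of_HMIX`).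

A finite BOOLEAN MODEL (HIERARCHY §11: the law of the random set `C = ⋃{T_k : ξ_k}` for independent coins `ξ_k` of biases `p_k` and tiles `T_k ⊆ [n]`; its
coverage events `B_i = {i ∈ C} = ⋃_{k : i ∈ T_k} {ξ_k}` are the OR-events / unions of independent events of the comb programme) is, BY CONSTRUCTION, an
iterated OR-mixture starting from the empty family: adding the tile `T_t` with coin `ξ_t` replaces `B_i` by `B_i ∪ [i ∈ T_t]·{ξ_t}` (`orCoin`).  We build it
literally so (`CoinSpace t = (⋯(Unit × Bool) × ⋯) × Bool`, `tileWeight`, `coverEvent`, recursion on the number of tiles) and prove: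
* `hereditaryAllOrders_coverEvent_zero` — the empty model (all `B_i = ∅`) is hereditarily all-orders positive (rows are `E_m` of families of `0`'s and `1`'s);
* **`hereditaryAllOrders_booleanModel_of_HMIX`** — `HereditaryMixturePositivity →` for every `n`, every tile sequence, all biases in `[0,1]` and every number of
  tiles `t`, the coverage family of the Boolean model is HEREDITARILY Sahi-nonnegative at every order (in particular all-orders positive: OR(∞) at the law level).
So the typed conjecture H-MIX carries the whole OR(∞) programme (HIERARCHY §11–§13); its AND twin is a theorem (`…SahiMixtureAnd`).  HONEST FRAMING: an
implication from an OPEN conjecture; nothing unconditional about Boolean models with ≥ 4 members is claimed here. [this work]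
-/

noncomputable section

open scoped Classical

namespace Summit.CriticalPhenomena.PercolationContinuityZ3.Theorems

open Finset Function
open Literature.Combinatorics.Sahi2008
open Literature.Probability.Percolation.DecisionTree (ind ind_of_mem ind_of_not_mem ind_nonneg)

namespace SahiMixture

/-! ### Boolean models as iterated coin spaces -/

/-- The space of the first `t` coins, built by iterated products: `CoinSpace 0 = Unit`, `CoinSpace (t+1) = CoinSpace t × Bool`. [this work] -/
def CoinSpace : ℕ → Type
  | 0 => Unit
  | t + 1 => CoinSpace t × Bool

/-- `CoinSpace t` is finite. [this work] -/
instance instFintypeCoinSpace : (t : ℕ) → Fintype (CoinSpace t)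
  | 0 => inferInstanceAs (Fintype Unit)
  | t + 1 => @instFintypeProd (CoinSpace t) Bool (instFintypeCoinSpace t) inferInstance

/-- The product weight of the first `t` coins with biases `p 0, …, p (t−1)`: `tileWeight p (t+1) = tileWeight p t ⊗ coin(p t)`. [this work] -/
def tileWeight (p : ℕ → ℝ) : (t : ℕ) → CoinSpace t → ℝ
  | 0 => fun _ => 1
  | t + 1 => coinWeight (tileWeight p t) (p t)

/-- The coverage events of the Boolean model with tiles `T 0, …, T (t−1)`: `B_i = ⋃_{k < t, i ∈ T k} {ξ_k}`, built by OR-ing the coin `ξ_t` into the members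
`i ∈ T t` (`coverEvent T (t+1) i = orCoin (coverEvent T t i) [i ∈ T t]`). [this work] -/
def coverEvent {n : ℕ} (T : ℕ → Finset (Fin n)) : (t : ℕ) → Fin n → Set (CoinSpace t)
  | 0 => fun _ => ∅
  | t + 1 => fun i => orCoin (coverEvent T t i) (decide (i ∈ T t))

section Facts

variable (p : ℕ → ℝ) (hp0 : ∀ k, 0 ≤ p k) (hp1 : ∀ k, p k ≤ 1)
include hp0 hp1

/-- The tile weight is nonnegative. [this work] -/
theorem tileWeight_nonneg : ∀ (t : ℕ) (x : CoinSpace t), 0 ≤ tileWeight p t x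
  | 0, _ => zero_le_one
  | t + 1, x => coinWeight_nonneg (tileWeight_nonneg t) (hp0 t) (hp1 t) x

omit hp0 hp1 in
/-- The tile weight is a probability weight. [this work] -/
theorem sum_tileWeight : ∀ t : ℕ, ∑ x, tileWeight p t x = 1
  | 0 => by show ∑ _x : Unit, (1 : ℝ) = 1; simp
  | t + 1 => sum_coinWeight (sum_tileWeight t) (p t)

end Facts

/-! ### The empty model and the induction on tiles -/

/-- **The empty Boolean model is hereditarily all-orders positive**: every member is `∅`, so a row is `E_m` of a family of zero functions and (for empty index
sets) constant `1`'s — `0` if a zero slot occurs, else `E_m(1,…,1) ∈ {0,1}`. [this work] -/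
theorem hereditaryAllOrders_coverEvent_zero {n : ℕ} (T : ℕ → Finset (Fin n)) (p : ℕ → ℝ) :
    HereditaryAllOrders (tileWeight p 0) (coverEvent T 0) := by
  intro m K
  by_cases hK : ∃ j, (K j).Nonempty
  · obtain ⟨j, i, hi⟩ := hK
    have hz : (fun j => ind (⋂ i ∈ K j, coverEvent T 0 i)) j = 0 := by
      funext x
      show ind (⋂ i ∈ K j, coverEvent T 0 i) x = 0
      refine ind_of_not_mem fun hx => ?_
      have := Set.mem_iInter₂.1 hx i hi
      simp [coverEvent] at this
    have e : (fun j => ind (⋂ i ∈ K j, coverEvent T 0 i)) = update (fun j => ind (⋂ i ∈ K j, coverEvent T 0 i)) j 0 := by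
      rw [eq_comm, update_eq_self_iff]; exact hz.symm
    rw [e, sahiE_update_zero]
  · have hK' : ∀ j, K j = ∅ := fun j => Finset.not_nonempty_iff_eq_empty.1 fun h => hK ⟨j, h⟩
    have e : (fun j => ind (⋂ i ∈ K j, coverEvent T 0 i)) = fun _ => (1 : CoinSpace 0 → ℝ) := by
      funext j x
      rw [hK' j]
      exact ind_of_mem (by simp)
    rw [e]
    have h1 : ∑ x, tileWeight p 0 x = 1 := sum_tileWeight p 0
    rcases m with _ | _ | m
    · rw [sahiE_zero]
    · rw [sahiE_one_apply]
      have : ex (tileWeight p 0) ((fun _ : Fin 1 => (1 : CoinSpace 0 → ℝ)) 0) = 1 := ex_one h1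
      rw [this]; exact zero_le_one
    · rw [sahiE_const_one h1 m]

/-- **H-MIX ⇒ OR(∞) (law level, hereditary form).**  Assuming the hereditary mixture conjecture, the coverage family of EVERY finite Boolean model (any number
`n` of members, any tiles, any biases in `[0,1]`, any number `t` of tiles) is hereditarily Sahi-nonnegative at every order: induction on the tiles, each step being
one OR-mixture (`hereditaryAllOrders_orCoin_of_HMIX`). [this work] -/
theorem hereditaryAllOrders_booleanModel_of_HMIX (hmix : HereditaryMixturePositivity) {n : ℕ} (T : ℕ → Finset (Fin n)) (p : ℕ → ℝ)
    (hp0 : ∀ k, 0 ≤ p k) (hp1 : ∀ k, p k ≤ 1) : ∀ t : ℕ, HereditaryAllOrders (tileWeight p t) (coverEvent T t)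
  | 0 => hereditaryAllOrders_coverEvent_zero T p
  | t + 1 =>
    hereditaryAllOrders_orCoin_of_HMIX hmix (tileWeight_nonneg p hp0 hp1 t) (sum_tileWeight p t) (coverEvent T t)
      (fun i => decide (i ∈ T t)) (hereditaryAllOrders_booleanModel_of_HMIX hmix T p hp0 hp1 t) (hp0 t) (hp1 t)

/-- In particular, under H-MIX every finite Boolean model is Sahi-nonnegative at every order (all multisets of coverage events). [this work] -/
theorem allOrders_booleanModel_of_HMIX (hmix : HereditaryMixturePositivity) {n : ℕ} (T : ℕ → Finset (Fin n)) (p : ℕ → ℝ)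
    (hp0 : ∀ k, 0 ≤ p k) (hp1 : ∀ k, p k ≤ 1) (t : ℕ) : AllOrders (tileWeight p t) (coverEvent T t) :=
  (hereditaryAllOrders_booleanModel_of_HMIX hmix T p hp0 hp1 t).allOrders

end SahiMixture

end Summit.CriticalPhenomena.PercolationContinuityZ3.Theorems

end
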